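import Literature.Probability.RandomPlanarGeometry.HexSAWStripWidthThreeContactKurtosis
import Literature.Probability.RandomPlanarGeometry.HexSAWStripWidthThreeContactVarianceClosedForm
import HarnessLib

/-!
# The width-three strip at criticality: the surface-contact count of long bridges is asymptotically UNSKEWED and MESOKURTIC —
# `skewness² → 0`, `excess kurtosis → 0`, `m₄/n² → 3σ₃⁴` (module «WIDTH-THREE CONTACT SHAPE»)

Topic `Literature/Probability/RandomPlanarGeometry` (continues «WIDTH-THREE CONTACT VARIANCE» (`W3.tendsto_varTopThree_div_hatLen`: `Var/n → σ₃²`), «… CLOSED FORM»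
(`W3.sigmaSqThree_window`: `σ₃² > 0.2756`), «WIDTH-THREE CONTACT SKEWNESS» (`W3.tendsto_thirdTopThree_div_hatLen`: `m₃/n → κ₃`) and «WIDTH-THREE CONTACT KURTOSIS»
(`W3.tendsto_fourthTopThree_div_hatLen`: `(m₄ − 3Var²)/n → κ₄`)).  Lane «pcv-sawmu» (CriticalPhenomena venture), a-p2 g29.  The three cumulant-rate laws
combine into the standard SHAPE statements for the number `N` of surface contacts of a critical `S₃` bridge `a → b` with `n = 2k + χ_a − χ_b` steps: the squared
skewness `m₃²/Var³ = (κ₃²/σ₃⁶)·n⁻¹ + o(n⁻¹) → 0`, the excess kurtosis `(m₄ − 3Var²)/Var² = (κ₄/σ₃⁴)·n⁻¹ + o(n⁻¹) → 0`, and the fourth central moment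
`m₄ ∼ 3σ₃⁴n²` — the third and fourth standardized moments of `N` converge to those of a Gaussian (`0` and `3`), consistent with (and necessary for) a CLT with
variance `σ₃²n`.  Frame: W. Feller, vol. II (1971) XVI.5 (moment convergence); nothing below is printed.

## What is proved (namespace `…SAW.HV.W3`)
* `tendsto_inv_hatLen_three` (`1/n → 0` along the hat chain), `sigmaSqThree_pos`, `one_le_hatLen_three`, `eventually_varTopThree_pos` (`Var > 0` eventually).
* ★★ **`tendsto_skewSq_three`**: `thirdTopThree k a b ^ 2 / varTopThree k a b ^ 3 → 0`.
* ★★ **`tendsto_excessKurt_three`**: `fourthTopThree k a b / varTopThree k a b ^ 2 → 0`.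
* ★★ **`tendsto_fourthCentral_div_sq_three`**: `(fourthTopThree k a b + 3·varTopThree k a b ^ 2) / n² → 3σ₃⁴` (`m₄ = (m₄ − 3Var²) + 3Var²`).

Label: LANE THEOREM (own result of lane «pcv-sawmu», a-p2 g29, 2026-08-28; not in print).  NOT claimed: the CLT itself (all standardized moments / tightness).
-/

noncomputable section

open Filter Topology Literature.Probability.LatticeModels Literature.Probability.Percolation

namespace Literature.Probability.RandomPlanarGeometry.SAW

namespace HV

namespace W3

/-- `1/(2k + χ_a − χ_b) → 0` (plumbing). [cite: Feller1968, XIII.3; lane plumbing] -/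
theorem tendsto_inv_hatLen_three (a b : Fin (2 * 3)) :
    Tendsto (fun k : ℕ => (((hatLen k a b : ℤ) : ℝ))⁻¹) atTop (𝓝 0) := by
  have h1 := tendsto_div_hatLen_three a b
  have h2 : Tendsto (fun k : ℕ => ((k : ℝ))⁻¹) atTop (𝓝 0) := tendsto_inv_atTop_zero.comp tendsto_natCast_atTop_atTop
  have t := h1.mul h2
  rw [mul_zero] at t
  refine t.congr' ?_
  filter_upwards [eventually_gt_atTop 0] with k hk
  have hk' : (k : ℝ) ≠ 0 := by exact_mod_cast hk.ne'
  field_simp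

/-- `σ₃² > 0` (from the window of «… CLOSED FORM»; plumbing). [cite: Feller1968, XIII.6; lane plumbing] -/
theorem sigmaSqThree_pos : 0 < sigmaSqThree := by linarith [sigmaSqThree_window.1]

/-- `1 ≤ 2k + χ_a − χ_b` for `k ≥ 1` (plumbing). [cite: Feller1968, XIII.3; lane plumbing] -/
theorem one_le_hatLen_three (a b : Fin (2 * 3)) {k : ℕ} (hk : 0 < k) : (1 : ℝ) ≤ ((hatLen k a b : ℤ) : ℝ) := by
  have h01 := (lchi_facts a).1
  have h02 := (lchi_facts b).1
  have h1 : (1 : ℤ) ≤ hatLen k a b := by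
    unfold hatLen
    rcases h01 with h | h <;> rcases h02 with h' | h' <;> omega
  exact_mod_cast h1

/-- Eventually `varTopThree k a b > 0` (plumbing: `Var/n → σ₃² > 0` and `n > 0`). [cite: Feller1968, XIII.6; lane plumbing] -/
theorem eventually_varTopThree_pos (a b : Fin (2 * 3)) : ∀ᶠ k : ℕ in atTop, 0 < varTopThree k a b := by
  have h := tendsto_varTopThree_div_hatLen a b
  have hev := h.eventually (Ioi_mem_nhds (half_lt_self sigmaSqThree_pos))
  filter_upwards [hev, eventually_gt_atTop 0] with k hk hk0
  have hL : (0 : ℝ) < ((hatLen k a b : ℤ) : ℝ) := lt_of_lt_of_le one_pos (one_le_hatLen_three a b hk0)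
  have hq : 0 < varTopThree k a b / ((hatLen k a b : ℤ) : ℝ) := lt_trans (half_pos sigmaSqThree_pos) hk
  rcases le_or_gt (varTopThree k a b) 0 with hneg | hpos
  · exfalso
    have : varTopThree k a b / ((hatLen k a b : ℤ) : ℝ) ≤ 0 := div_nonpos_of_nonpos_of_nonneg hneg hL.le
    linarith
  · exact hpos

/-- ★★ **Squared skewness → 0**: `m₃² / Var³ → 0` for the contact count of critical `S₃` bridges `a → b` (`= (κ₃²/σ₃⁶)/n + o(1/n)`).
[cite: Feller1968, XIII.6; lane «pcv-sawmu» a-p2 g29 — own result, not in print] -/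
theorem tendsto_skewSq_three (a b : Fin (2 * 3)) :
    Tendsto (fun k : ℕ => thirdTopThree k a b ^ 2 / varTopThree k a b ^ 3) atTop (𝓝 0) := by
  have h3 := tendsto_thirdTopThree_div_hatLen a b
  have h2 := tendsto_varTopThree_div_hatLen a b
  have hi := tendsto_inv_hatLen_three a b
  have hσ : sigmaSqThree ^ 3 ≠ 0 := pow_ne_zero 3 sigmaSqThree_pos.ne'
  have t := ((h3.pow 2).div (h2.pow 3) hσ).mul hi
  rw [mul_zero] at t
  refine t.congr' ?_
  filter_upwards [eventually_varTopThree_pos a b, eventually_gt_atTop 0] with k hv hk0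
  have hL : ((hatLen k a b : ℤ) : ℝ) ≠ 0 := by linarith [one_le_hatLen_three a b hk0]
  have hv' : varTopThree k a b ≠ 0 := hv.ne'
  simp only [Pi.div_apply]
  field_simp

/-- ★★ **Excess kurtosis → 0**: `(m₄ − 3Var²) / Var² → 0` for the contact count of critical `S₃` bridges `a → b` (`= (κ₄/σ₃⁴)/n + o(1/n)`).
[cite: Feller1968, XIII.6; lane «pcv-sawmu» a-p2 g29 — own result, not in print] -/
theorem tendsto_excessKurt_three (a b : Fin (2 * 3)) :
    Tendsto (fun k : ℕ => fourthTopThree k a b / varTopThree k a b ^ 2) atTop (𝓝 0) := by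
  have h4 := tendsto_fourthTopThree_div_hatLen a b
  have h2 := tendsto_varTopThree_div_hatLen a b
  have hi := tendsto_inv_hatLen_three a b
  have hσ : sigmaSqThree ^ 2 ≠ 0 := pow_ne_zero 2 sigmaSqThree_pos.ne'
  have t := (h4.div (h2.pow 2) hσ).mul hi
  rw [mul_zero] at t
  refine t.congr' ?_
  filter_upwards [eventually_varTopThree_pos a b, eventually_gt_atTop 0] with k hv hk0
  have hL : ((hatLen k a b : ℤ) : ℝ) ≠ 0 := by linarith [one_le_hatLen_three a b hk0]
  have hv' : varTopThree k a b ≠ 0 := hv.ne'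
  simp only [Pi.div_apply]
  field_simp

/-- ★★ **The fourth central moment is `3σ₃⁴n²`**: `(fourthTopThree + 3·varTopThree²) / n² → 3σ₃⁴` (`m₄ = (m₄ − 3Var²) + 3Var²`; the Gaussian fourth moment).
[cite: Feller1968, XIII.6; lane «pcv-sawmu» a-p2 g29 — own result, not in print] -/
theorem tendsto_fourthCentral_div_sq_three (a b : Fin (2 * 3)) :
    Tendsto (fun k : ℕ => (fourthTopThree k a b + 3 * varTopThree k a b ^ 2) / ((hatLen k a b : ℤ) : ℝ) ^ 2) atTop (𝓝 (3 * sigmaSqThree ^ 2)) := by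
  have h4 := tendsto_fourthTopThree_div_hatLen a b
  have h2 := tendsto_varTopThree_div_hatLen a b
  have hi := tendsto_inv_hatLen_three a b
  have t := (h4.mul hi).add ((h2.pow 2).const_mul 3)
  rw [mul_zero, zero_add] at t
  refine t.congr' ?_
  filter_upwards [eventually_gt_atTop 0] with k hk0
  rw [div_pow]
  ring

end W3

end HV

end Literature.Probability.RandomPlanarGeometry.SAW
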